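import Summits.Ventures.QEC.CircuitDistance.PortFibreReduction
import HarnessLib

/-!
# P3-PORT (D4): budget-aware COVERAGE and realisations from leaf facts of any shape (cell `qec`, experiment CDX, seat
# qec-cdx-type-1; fix-forward of `PortFibreReduction`)

* `Leaf.realisation_solves`: the indicator assignment of a realisation of a well-formed leaf solves `Q_any(rows, us, w)` and
  selects exactly the realisation's null coordinates — so ANY refutation of such assignments refutes realisations:
  `Leaf.not_realised_of_noSolution` (monolithic `¬∃ a, SolvesAny …`, e.g. from `.Unsat` or from a group-cube cover) and
  **`Leaf.not_realised_of_nullSplit`** (budget `≤ 1`: «no solution with all nulls false» + «for each null `c`, no solution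
  with exactly `c` true» — eng-1's per-usable-null leaves for the `b = 1` words);
* `Covers₀` = `Covers` with the null clause required only when the budget is positive (for `b = 0` leaves `nulls = []`), and
  **`not_tightRealisable_of_notRealised₀`**: coverage + well-formed + `¬ Realised` + budget `≤ 1` ⇒ no tight realisation.
Generic; nothing here mentions a circuit.
-/

namespace Summit.Ventures.QEC.CircuitDistance.Fibre

open Finset

variable {ι δ γ V : Type*} [DecidableEq ι] [DecidableEq δ] [DecidableEq γ]
variable [AddCommGroup V] [Module (ZMod 2) V]

/-! ## Realisations solve the leaf's question -/

/-- **The indicator assignment of a realisation solves `Q_any`** (and is `true` exactly on the chosen null coordinates among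
the nulls). -/
theorem Leaf.realisation_solves (L : Leaf) (hwf : L.wf = true) (pick : Fin L.k → ℕ) (N : Finset ℕ)
    (hpick : ∀ j : Fin L.k, pick j ∈ L.group (j : ℕ)) (hN : ∀ c ∈ N, c ∈ L.nulls) (hNcard : N.card ≤ L.budget)
    (heven : ∀ d, Even ((Finset.univ.filter fun j : Fin L.k => d ∈ L.coordsOf (pick j)).card +
      (N.filter fun c => d ∈ L.coordsOf c).card)) :
    Census.CNFEncode.SolvesAny L.n L.rows L.us L.w (fun c => decide (c ∈ (Finset.univ.image pick) ∪ N)) ∧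
      (∀ r ∈ L.rows, ∀ i ∈ r, i < L.n) ∧ (∀ u ∈ L.us, ∀ i ∈ u, i < L.n) ∧
      (∀ c ∈ L.nulls, (decide (c ∈ (Finset.univ.image pick) ∪ N) = true ↔ c ∈ N)) := by
  classical
  simp only [Leaf.wf, Bool.and_eq_true, decide_eq_true_eq, List.all_eq_true, List.any_eq_true] at hwf
  obtain ⟨⟨⟨⟨⟨hk, hlt⟩, hnodup⟩, hrows⟩, hus⟩, hkw⟩ := hwf
  have hnd := List.nodup_append.1 hnodup
  have hflat_nd : L.groups.flatten.Nodup := hnd.1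
  have hdisjN : ∀ c ∈ L.groups.flatten, c ∉ L.nulls := fun c hc hcn => hnd.2.2 c hc c hcn rfl
  have hgroups_nd : ∀ l ∈ L.groups, l.Nodup := (List.nodup_flatten.1 hflat_nd).1
  have hgroups_pw : L.groups.Pairwise List.Disjoint := (List.nodup_flatten.1 hflat_nd).2
  set T : Finset ℕ := (Finset.univ.image pick) ∪ N with hT
  have hpick_lt : ∀ j, pick j < L.n := fun j =>
    hlt _ (List.mem_append_left _ (mem_flatten_of_mem_group L j.2 (hpick j)))
  have hT_lt : ∀ c ∈ T, c < L.n := by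
    intro c hc
    rcases Finset.mem_union.1 hc with hc | hc
    · obtain ⟨j, -, rfl⟩ := Finset.mem_image.1 hc; exact hpick_lt j
    · exact hlt _ (List.mem_append_right _ (hN c hc))
  have hdisjgrp : ∀ j j' : Fin L.k, j ≠ j' → List.Disjoint (L.group j) (L.group j') := by
    intro j j' hne
    have hne' : (j : ℕ) ≠ j' := fun e => hne (Fin.ext e)
    unfold Leaf.group
    rw [List.getD_eq_getElem _ _ j.2, List.getD_eq_getElem _ _ j'.2]
    rcases Nat.lt_or_gt_of_ne hne' with hlt' | hlt'
    · exact List.Pairwise.rel_get_of_lt (R := List.Disjoint) hgroups_pw (a := ⟨j, j.2⟩) (b := ⟨j', j'.2⟩) hlt'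
    · exact (List.Pairwise.rel_get_of_lt (R := List.Disjoint) hgroups_pw (a := ⟨j', j'.2⟩) (b := ⟨j, j.2⟩) hlt').symm
  have hpick_inj : Function.Injective pick := by
    intro j j' hjj'
    by_contra hne
    exact hdisjgrp j j' hne (hpick j) (hjj' ▸ hpick j')
  have hdisj : Disjoint (Finset.univ.image pick) N := by
    rw [Finset.disjoint_left]
    intro c hc hcN
    obtain ⟨j, -, rfl⟩ := Finset.mem_image.1 hc
    exact hdisjN _ (mem_flatten_of_mem_group L j.2 (hpick j)) (hN _ hcN)
  have hcount_group : ∀ j : Fin L.k, (L.group j).countP (fun c => decide (c ∈ T)) = 1 := by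
    intro j
    have hgnd : (L.group j).Nodup := hgroups_nd _ (group_mem_groups L j.2)
    rw [countP_mem_eq_card _ hgnd, Finset.card_eq_one]
    refine ⟨pick j, ?_⟩
    ext c
    simp only [Finset.mem_inter, List.mem_toFinset, Finset.mem_singleton]
    constructor
    · rintro ⟨hc, hcT⟩
      rcases Finset.mem_union.1 hcT with hcT | hcT
      · obtain ⟨j', -, rfl⟩ := Finset.mem_image.1 hcT
        by_cases hjj : j' = j
        · rw [hjj]
        · exact absurd hc (fun hc => hdisjgrp j' j hjj (hpick j') hc)
      · exact absurd (hN _ hcT) (hdisjN _ (mem_flatten_of_mem_group L j.2 hc))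
    · rintro rfl; exact ⟨hpick j, Finset.mem_union_left _ (Finset.mem_image_of_mem _ (Finset.mem_univ _))⟩
  have hgroup_lt : ∀ j, ∀ c ∈ L.group j, c < L.n := by
    intro j c hc
    by_cases hj : j < L.k
    · exact hlt _ (List.mem_append_left _ (mem_flatten_of_mem_group L hj hc))
    · unfold Leaf.group at hc; rw [List.getD_eq_default _ _ (not_lt.1 hj)] at hc; simp at hc
  have hadm_lt : ∀ r ∈ L.admissible, ∀ c ∈ r, c < L.n := by
    intro r hr c hc
    unfold Leaf.admissible at hr
    rcases List.mem_append.1 hr with hr | hr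
    · obtain ⟨d, -, rfl⟩ := List.mem_map.1 hr
      unfold Leaf.detRow at hc
      exact List.mem_range.1 (List.mem_filter.1 hc).1
    · obtain ⟨j, -, rfl⟩ := List.mem_map.1 hr
      rcases List.mem_append.1 hc with hc | hc
      · exact hgroup_lt 0 c hc
      · exact hgroup_lt j c hc
  have hrows_lt : ∀ r ∈ L.rows, ∀ i ∈ r, i < L.n := by
    intro r hr i hi
    obtain ⟨adm, hadm, hperm⟩ := hrows r hr
    exact hadm_lt adm hadm i (hperm.subset hi)
  have hus_lt : ∀ u ∈ L.us, ∀ i ∈ u, i < L.n := by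
    rw [hus]; intro u hu i hi
    rw [List.mem_singleton] at hu; subst hu
    exact hgroup_lt 0 i hi
  refine ⟨⟨?_, ?_, ?_⟩, hrows_lt, hus_lt, ?_⟩
  · intro r hr
    obtain ⟨adm, hadm, hperm⟩ := hrows r hr
    rw [Bool.eq_false_iff, Ne, lparity_iff_odd, hperm.countP_eq, Nat.not_odd_iff_even]
    unfold Leaf.admissible at hadm
    rcases List.mem_append.1 hadm with hadm | hadm
    · obtain ⟨d, -, rfl⟩ := List.mem_map.1 hadm
      have hnd' : (L.detRow d).Nodup := (List.nodup_range).filter _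
      show Even ((L.detRow d).countP fun c => decide (c ∈ T))
      rw [countP_mem_eq_card _ hnd']
      have hset : (L.detRow d).toFinset ∩ T = T.filter fun c => d ∈ L.coordsOf c := by
        ext c
        simp only [Leaf.detRow, Finset.mem_inter, List.mem_toFinset, List.mem_filter, List.mem_range,
          Finset.mem_filter, decide_eq_true_eq]
        constructor
        · rintro ⟨⟨-, h2⟩, h3⟩; exact ⟨h3, h2⟩
        · rintro ⟨h1, h2⟩; exact ⟨⟨hT_lt c h1, h2⟩, h1⟩
      rw [hset, hT, Finset.filter_union, Finset.card_union_of_disjoint (Finset.disjoint_filter_filter hdisj),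
        Finset.filter_image, Finset.card_image_of_injective _ hpick_inj]
      exact heven d
    · obtain ⟨j, hj, rfl⟩ := List.mem_map.1 hadm
      have hj' : j < L.k := List.mem_range.1 (List.mem_filter.1 hj).1
      rw [List.countP_append, hcount_group ⟨0, hk⟩, hcount_group ⟨j, hj'⟩]
      exact ⟨1, rfl⟩
  · refine ⟨L.group 0, by rw [hus]; exact List.mem_singleton_self _, ?_⟩
    rw [lparity_iff_odd, hcount_group ⟨0, hk⟩]
    exact odd_one
  · show (List.range L.n).countP (fun c => decide (c ∈ T)) ≤ L.w
    rw [countP_mem_eq_card _ List.nodup_range]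
    calc ((List.range L.n).toFinset ∩ T).card ≤ T.card := Finset.card_le_card Finset.inter_subset_right
      _ ≤ (Finset.univ.image pick).card + N.card := Finset.card_union_le _ _
      _ ≤ L.k + L.budget := by
          apply Nat.add_le_add _ hNcard
          exact (Finset.card_image_le).trans (by simp)
      _ = L.w := by unfold Leaf.budget; omega
  · intro c hc
    rw [decide_eq_true_eq, hT, Finset.mem_union]
    constructor
    · rintro (h | h)
      · obtain ⟨j, -, rfl⟩ := Finset.mem_image.1 h
        exact absurd hc (hdisjN _ (mem_flatten_of_mem_group L j.2 (hpick j)))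
      · exact h
    · exact Or.inr

/-- A leaf with NO solution of its question (in whatever way that was certified) has no realisation. -/
theorem Leaf.not_realised_of_noSolution (L : Leaf) (hwf : L.wf = true)
    (h : ¬ ∃ a, Census.CNFEncode.SolvesAny L.n L.rows L.us L.w a) : ¬ L.Realised := by
  rintro ⟨pick, N, hpick, hN, hNcard, heven⟩
  exact h ⟨_, (Leaf.realisation_solves L hwf pick N hpick hN hNcard heven).1⟩

/-- **NULL-SPLIT.** A budget-`≤ 1` leaf with no solution selecting no null coordinate and, for each null coordinate `c`,
no solution selecting exactly `c` among the nulls, has no realisation. -/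
theorem Leaf.not_realised_of_nullSplit (L : Leaf) (hwf : L.wf = true) (hb : L.budget ≤ 1)
    (h0 : ¬ ∃ a, Census.CNFEncode.SolvesAny L.n L.rows L.us L.w a ∧ ∀ c ∈ L.nulls, a c = false)
    (hc : ∀ c ∈ L.nulls, ¬ ∃ a, Census.CNFEncode.SolvesAny L.n L.rows L.us L.w a ∧ a c = true ∧
      ∀ c' ∈ L.nulls, c' ≠ c → a c' = false) : ¬ L.Realised := by
  classical
  rintro ⟨pick, N, hpick, hN, hNcard, heven⟩
  obtain ⟨hsol, -, -, hnull⟩ := Leaf.realisation_solves L hwf pick N hpick hN hNcard heven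
  have hN1 : N.card ≤ 1 := hNcard.trans hb
  rcases Nat.lt_or_ge N.card 1 with h0' | h1'
  · have hNe : N = ∅ := Finset.card_eq_zero.1 (by omega)
    refine h0 ⟨_, hsol, fun c hc' => ?_⟩
    rw [Bool.eq_false_iff]
    intro ht
    have := (hnull c hc').1 ht
    rw [hNe] at this; simp at this
  · obtain ⟨c, hcN⟩ := Finset.card_eq_one.1 (le_antisymm hN1 h1')
    have hcmem : c ∈ N := by rw [hcN]; exact Finset.mem_singleton_self _
    refine hc c (hN c hcmem) ⟨_, hsol, (hnull c (hN c hcmem)).2 hcmem, fun c' hc' hne => ?_⟩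
    rw [Bool.eq_false_iff]
    intro ht
    have := (hnull c' hc').1 ht
    rw [hcN, Finset.mem_singleton] at this
    exact hne this

/-! ## Budget-aware coverage -/

/-- COVERAGE, budget-aware: as `Covers`, but the null clause is required only when the budget is positive. -/
def Covers₀ (D : DEM ι δ γ V) (scope : Set ι) (enc : δ → ℕ) (xs : List γ) (L : Leaf) : Prop :=
  Function.Injective enc ∧ xs.length = L.k ∧
  (∀ i ∈ scope, ∀ j : Fin xs.length, D.cls i = some xs[j] →
      ∃ c ∈ L.group j, (L.coordsOf c).toFinset = (D.det i).image enc) ∧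
  (L.budget = 0 ∨
    ∀ i ∈ scope, D.cls i = none → D.det i = ∅ ∨ ∃ c ∈ L.nulls, (L.coordsOf c).toFinset = (D.det i).image enc)

/-- **No tight realisation from an unrealised covered leaf** (budget `≤ 1`). -/
theorem not_tightRealisable_of_notRealised₀ (D : DEM ι δ γ V) (scope : Set ι) (enc : δ → ℕ) (xs : List γ)
    (hxs : xs.Nodup) (L : Leaf) (hcov : Covers₀ D scope enc xs L) (hnr : ¬ L.Realised) (hb : L.budget ≤ 1) :
    ¬ TightRealisable D scope xs.toFinset L.budget := by
  classical
  obtain ⟨henc, hlen, hcovG, hcovN⟩ := hcov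
  rintro ⟨F, hscope, hsil, hproj, hcard⟩
  have hxcard : xs.toFinset.card = xs.length := List.toFinset_card_of_nodup hxs
  obtain ⟨h1, h2, h3⟩ := tight_of_budget_le_one D F (by rw [hproj]; omega)
  have hcardk : F.card ≤ L.k + L.budget := by rw [hxcard, hlen] at hcard; exact hcard
  have h3k : nullCount D F + L.k = F.card := by rw [hproj, hxcard, hlen] at h3; exact h3
  have hjlt : ∀ j : Fin L.k, (j : ℕ) < xs.length := fun j => j.2.trans_eq hlen.symm
  have hmem : ∀ j : Fin L.k, xs[(j : ℕ)]'(hjlt j) ∈ proj D F := by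
    intro j; rw [hproj, List.mem_toFinset]; exact List.getElem_mem _
  have hex : ∀ j : Fin L.k, ∃ i, F.filter (fun i => D.cls i = some (xs[(j : ℕ)]'(hjlt j))) = {i} :=
    fun j => Finset.card_eq_one.1 (h1 _ (hmem j))
  choose col hcol using hex
  have hcol_mem : ∀ j, col j ∈ F ∧ D.cls (col j) = some (xs[(j : ℕ)]'(hjlt j)) := by
    intro j
    have : col j ∈ F.filter (fun i => D.cls i = some (xs[(j : ℕ)]'(hjlt j))) := by
      rw [hcol j]; exact Finset.mem_singleton_self _
    exact Finset.mem_filter.1 this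
  have hcol_inj : Function.Injective col := by
    intro j j' hjj'
    have e := (hcol_mem j).2.symm.trans (hjj' ▸ (hcol_mem j').2)
    exact Fin.ext ((List.Nodup.getElem_inj_iff hxs).1 (Option.some_injective _ e))
  have hnonnull : ∀ i ∈ F, D.cls i ≠ none → ∃ j, i = col j := by
    intro i hi hne
    obtain ⟨g, hg⟩ := Option.ne_none_iff_exists'.1 hne
    have hgproj : g ∈ proj D F := by
      by_contra hng
      have := h2 g hng
      unfold mult at this
      rw [Finset.card_eq_zero, Finset.filter_eq_empty_iff] at this
      exact this hi hg
    rw [hproj, List.mem_toFinset] at hgproj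
    obtain ⟨jn, hjn, rfl⟩ := List.getElem_of_mem hgproj
    refine ⟨⟨jn, hjn.trans_eq hlen⟩, ?_⟩
    have : i ∈ F.filter (fun i' => D.cls i' = some (xs[jn]'hjn)) := Finset.mem_filter.2 ⟨hi, hg⟩
    rw [hcol ⟨jn, hjn.trans_eq hlen⟩] at this
    exact Finset.mem_singleton.1 this
  have hpickex : ∀ j : Fin L.k, ∃ c ∈ L.group j, (L.coordsOf c).toFinset = (D.det (col j)).image enc := by
    intro j
    exact hcovG (col j) (hscope _ (hcol_mem j).1) ⟨j, hjlt j⟩ (hcol_mem j).2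
  choose pick hpick hpickc using hpickex
  set P := F.filter (fun i => D.cls i = none) with hP
  have hPcard : P.card ≤ 1 := by
    have : P.card = nullCount D F := rfl
    omega
  have hFsplit : F = (Finset.univ.image col) ∪ P := by
    ext i
    simp only [Finset.mem_union, Finset.mem_image, Finset.mem_univ, true_and, hP, Finset.mem_filter]
    constructor
    · intro hi
      by_cases hc : D.cls i = none
      · exact Or.inr ⟨hi, hc⟩
      · obtain ⟨j, rfl⟩ := hnonnull i hi hc; exact Or.inl ⟨j, rfl⟩
    · rintro (⟨j, rfl⟩ | ⟨hi, -⟩)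
      · exact (hcol_mem j).1
      · exact hi
  have hdisj : Disjoint (Finset.univ.image col) P := by
    rw [Finset.disjoint_left]
    intro i hi hiP
    obtain ⟨j, -, rfl⟩ := Finset.mem_image.1 hi
    have := (Finset.mem_filter.1 hiP).2
    rw [(hcol_mem j).2] at this
    exact Option.some_ne_none _ this
  have hcount_gen : ∀ d : ℕ, ((Finset.univ.image col).filter fun i => d ∈ (D.det i).image enc).card =
      (Finset.univ.filter fun j : Fin L.k => d ∈ L.coordsOf (pick j)).card := by
    intro d
    rw [Finset.filter_image, Finset.card_image_of_injective _ hcol_inj]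
    congr 1
    ext j
    simp only [Finset.mem_filter, Finset.mem_univ, true_and]
    rw [← List.mem_toFinset, hpickc j]
  have hsilenc : ∀ d : ℕ, Even ((F.filter fun i => d ∈ (D.det i).image enc).card) := by
    intro d
    by_cases hd : ∃ d', enc d' = d
    · obtain ⟨d', rfl⟩ := hd
      have : (F.filter fun i => enc d' ∈ (D.det i).image enc) = F.filter fun i => d' ∈ D.det i := by
        apply Finset.filter_congr
        intro i _
        rw [Finset.mem_image]
        constructor
        · rintro ⟨d'', h1, h2⟩; exact henc h2 ▸ h1
        · intro h1; exact ⟨d', h1, rfl⟩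
      rw [this]; exact hsil d'
    · have : (F.filter fun i => d ∈ (D.det i).image enc) = ∅ := by
        rw [Finset.filter_eq_empty_iff]
        intro i _ hmem
        obtain ⟨d', -, hd'⟩ := Finset.mem_image.1 hmem
        exact hd ⟨d', hd'⟩
      rw [this]; exact ⟨0, rfl⟩
  apply hnr
  rcases Nat.lt_or_ge P.card 1 with hP0 | hP1
  · have hPe : P = ∅ := Finset.card_eq_zero.1 (by omega)
    refine ⟨pick, ∅, hpick, by simp, by simp, ?_⟩
    intro d
    have := hsilenc d
    rw [hFsplit, Finset.filter_union, Finset.card_union_of_disjoint (Finset.disjoint_filter_filter hdisj),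
      hcount_gen, hPe] at this
    simpa using this
  · have hP1' : P.card = 1 := le_antisymm hPcard hP1
    obtain ⟨p, hp⟩ := Finset.card_eq_one.1 hP1'
    have hpF : p ∈ F ∧ D.cls p = none := by
      have : p ∈ P := by rw [hp]; exact Finset.mem_singleton_self _
      exact Finset.mem_filter.1 this
    -- the budget is positive here, so the null clause is available
    have hbpos : L.budget ≠ 0 := by
      have hPn : P.card = nullCount D F := rfl
      omega
    have hcovN' := hcovN.resolve_left hbpos
    rcases hcovN' p (hscope p hpF.1) hpF.2 with hdet | ⟨c, hcn, hcc⟩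
    · refine ⟨pick, ∅, hpick, by simp, by simp, ?_⟩
      intro d
      have := hsilenc d
      rw [hFsplit, Finset.filter_union, Finset.card_union_of_disjoint (Finset.disjoint_filter_filter hdisj),
        hcount_gen, hp] at this
      have h0 : (({p} : Finset ι).filter fun i => d ∈ (D.det i).image enc).card = 0 := by
        rw [Finset.card_eq_zero, Finset.filter_eq_empty_iff]
        intro i hi
        rw [Finset.mem_singleton.1 hi, hdet]; simp
      rw [h0] at this
      simpa using this
    · refine ⟨pick, {c}, hpick, by simpa using hcn, ?_, ?_⟩
      · have hPn : P.card = nullCount D F := rfl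
        have : 1 ≤ L.budget := by omega
        simpa using this
      · intro d
        have := hsilenc d
        rw [hFsplit, Finset.filter_union, Finset.card_union_of_disjoint (Finset.disjoint_filter_filter hdisj),
          hcount_gen, hp] at this
        have hc1 : (({c} : Finset ℕ).filter fun c' => d ∈ L.coordsOf c').card =
            (({p} : Finset ι).filter fun i => d ∈ (D.det i).image enc).card := by
          by_cases hd : d ∈ L.coordsOf c
          · have hd' : d ∈ (D.det p).image enc := by rw [← hcc]; exact List.mem_toFinset.2 hd
            rw [Finset.filter_singleton, Finset.filter_singleton, if_pos hd, if_pos hd']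
            simp
          · have hd' : d ∉ (D.det p).image enc := by rw [← hcc]; exact fun h => hd (List.mem_toFinset.1 h)
            have e1 : (({c} : Finset ℕ).filter fun c' => d ∈ L.coordsOf c') = ∅ := by
              rw [Finset.filter_singleton, if_neg hd]
            have e2 : (({p} : Finset ι).filter fun i => d ∈ (D.det i).image enc) = ∅ := by
              rw [Finset.filter_singleton, if_neg hd']
            rw [e1, e2, Finset.card_empty, Finset.card_empty]
        rw [hc1]; exact this

end Summit.Ventures.QEC.CircuitDistance.Fibre
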